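import Summits.HubbardSuperconductivity.HubbardSuperconductivity.Theorems.AnisotropyChordTransferCompressibilityBEC
import Summits.HubbardSuperconductivity.HubbardSuperconductivity.Theorems.AnisotropyChordTransferFsumBound

/-!
# Route `AnisotropyChord` / H0 rotor rung, route (1): PROPOSITION N WITH HYPOTHESIS F DISCHARGED —
# (H2) ⇐ K (compressibility) + R₀ (`k = 0` Feynman saturation), and END-TO-END K ∧ R₀ ⇒ BEC
# (theory seat `hubbard-h0-rotor-theory-1` g12, memo ROTOR-THEORY-12 §184; prover seat `hubbard-h0-rotor-p1` g15)

With HYPOTHESIS F proved (`fsumLower_eventually`: `FsumLower L Δ j ((1−Δ)/4)` on `|j| ≤ k + 1`, eventually in `L`, for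
`0 ≤ Δ ≤ 1`), the compressibility chain of PROPOSITION N loses one hypothesis:

* `symmetricSectorGap_of_compressibility_KR` — K ∧ R₀ (uniform `κ > 0`, `c_s ≥ 0` on `|j| ≤ k`, eventually in `L`) ⇒ the tree's
  (H2) `SymmetricSectorGap Δ (c_s √((1−Δ)/4/κ)) k`;
* **`condensate_of_compressibility_KR`** — for `0 ≤ Δ < 1`: anchor + K ∧ R₀ on `|j| ≤ k + 1` ⇒ `CondensateOnFirstSectors Δ k`;
* **`condensate_xy_of_compressibility_KR`** — the XY point (anchor = KLS in the tree): K ∧ R₀ ⇒ BEC at `N = L²/2 + j`, `j ≤ k`.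

The residual inputs are the TARGET's compressibility K and the open `k = 0` saturation R₀ (critic-4 g9: OPEN; Landau–Feynman).
-/

set_option linter.dupNamespace false
set_option autoImplicit false

noncomputable section

open Finset Filter Topology
open Literature.MathematicalPhysics.QuantumLattice Literature.Probability.LatticeModels
open Summit.HubbardSuperconductivity.HubbardSuperconductivity.Theorems.AnisotropyChord.InsertionEntropy
open Summit.HubbardSuperconductivity.HubbardSuperconductivity.Theorems.AnisotropyChord.Tower

namespace Summit.HubbardSuperconductivity.HubbardSuperconductivity.Theorems.AnisotropyChord.Transfer

/-- **(H2) ⇐ K + R₀ (F discharged):** compressibility and `k = 0` Feynman saturation with uniform constants on the sectors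
`|j| ≤ k`, eventually in `L`, give the tree's (H2) with `c₁ = c_s √((1−Δ)/(4κ))`, for `0 ≤ Δ ≤ 1`.
[conjecture: theory seat hubbard-h0-rotor-theory-1, cycle 12, PROPOSITION N — PROVED here with F discharged] -/
theorem symmetricSectorGap_of_compressibility_KR {Δ κ cs : ℝ} {k : ℕ} (hΔ0 : 0 ≤ Δ) (hΔ1 : Δ ≤ 1)
    (hκ : 0 < κ) (hcs : 0 ≤ cs)
    (h : ∀ᶠ L : ℕ in atTop, ∀ [NeZero L], ∀ j : ℤ, |j| ≤ (k : ℤ) →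
      DensityResponseBound L Δ (j : ℝ) κ ∧ PhononSaturationBelowSym (L := L) Δ (j : ℝ) cs) :
    SymmetricSectorGap Δ (cs * Real.sqrt ((1 - Δ) / 4 / κ)) k := by
  apply symmetricSectorGap_of_compressibility_saturation hκ hcs
  have hF := fsumLower_eventually hΔ0 hΔ1 k
  filter_upwards [h, hF] with L hL hFL
  intro _ j hj
  obtain ⟨hK, hR⟩ := hL j hj
  have hj' : |j| ≤ ((k + 1 : ℕ) : ℤ) := le_trans hj (by push_cast; linarith)
  exact ⟨hK, hFL j hj', hR⟩

/-- **END-TO-END TO BEC with F discharged (`0 ≤ Δ < 1`):** KLS-type anchor `HalfFillingAnchor Δ c₀` + compressibility K + `k = 0`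
Feynman saturation R₀ (uniform `0 < κ`, `0 < c_s` on `|j| ≤ k + 1`, eventually in `L`) ⇒ `CondensateOnFirstSectors Δ k`.
[conjecture: theory seat hubbard-h0-rotor-theory-1, cycle 12 — PROVED here from the tree's conditional T, F discharged] -/
theorem condensate_of_compressibility_KR {Δ κ cs c₀ : ℝ} {k : ℕ} (hΔ0 : 0 ≤ Δ) (hΔ1 : Δ < 1)
    (hκ : 0 < κ) (hcs : 0 < cs) (hc₀ : 0 < c₀) (hA : HalfFillingAnchor Δ c₀)
    (h : ∀ᶠ L : ℕ in atTop, ∀ [NeZero L], ∀ j : ℤ, |j| ≤ ((k + 1 : ℕ) : ℤ) →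
      DensityResponseBound L Δ (j : ℝ) κ ∧ PhononSaturationBelowSym (L := L) Δ (j : ℝ) cs) :
    CondensateOnFirstSectors Δ k := by
  have hf₀ : 0 < (1 - Δ) / 4 := by linarith
  apply condensate_of_compressibility_saturation hΔ0 hΔ1 hκ hf₀ hcs hc₀ hA
  have hF := fsumLower_eventually hΔ0 hΔ1.le k
  filter_upwards [h, hF] with L hL hFL
  intro _ j hj
  obtain ⟨hK, hR⟩ := hL j hj
  exact ⟨hK, hFL j hj, hR⟩

/-- **END-TO-END at the XY point (hard-core bosons on `(ℤ/L)²`, anchor = KLS 1988 in the tree), F discharged:** compressibility K +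
`k = 0` Feynman saturation R₀ on the sectors `|j| ≤ k + 1`, eventually in `L` ⇒ BEC in every sector `N = L²/2 + j`, `j ≤ k`.
[conjecture: theory seat hubbard-h0-rotor-theory-1, cycle 12 — PROVED here from the tree's conditional T, F discharged] -/
theorem condensate_xy_of_compressibility_KR {κ cs : ℝ} {k : ℕ} (hκ : 0 < κ) (hcs : 0 < cs)
    (h : ∀ᶠ L : ℕ in atTop, ∀ [NeZero L], ∀ j : ℤ, |j| ≤ ((k + 1 : ℕ) : ℤ) →
      DensityResponseBound L 0 (j : ℝ) κ ∧ PhononSaturationBelowSym (L := L) 0 (j : ℝ) cs) :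
    CondensateOnFirstSectors 0 k := by
  apply condensate_xy_of_compressibility_saturation (f₀ := (1 - 0) / 4) hκ (by norm_num) hcs
  have hF := fsumLower_eventually (Δ := 0) le_rfl zero_le_one k
  filter_upwards [h, hF] with L hL hFL
  intro _ j hj
  obtain ⟨hK, hR⟩ := hL j hj
  exact ⟨hK, hFL j hj, hR⟩

end Summit.HubbardSuperconductivity.HubbardSuperconductivity.Theorems.AnisotropyChord.Transfer
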